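import Literature.Barriers.SmoothPoincare4.CappellShanesonFamilyStandardProofs
import HarnessLib

/-!
# `FamilyStandard`: what the discharge `FamilyStandard_holds` amounts to

Sibling proof file of `Literature/Barriers/SmoothPoincare4/CappellShanesonFamilyStandardProofs.lean`,
working towards the discharge of its auxiliary named fact
`Literature.Barriers.SmoothPoincare4.FamilyStandard.{u}` — the tree's named fact
`Literature.Topology.FourManifolds.nonempty_diffeomorph_sphere_four_of_isCappellShanesonSphereOf X`
closed over all closed smooth `X : Type u`, i.e. R. Gompf, *More Cappell–Shaneson spheres are
standard*, Algebr. Geom. Topol. 10 (2010), Examples 3.1(a): "Since `Aₘ` is in standard form with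
`d = 1`, we can change it to have any trace, say `2`. The resulting matrix … must be conjugate to
`A₀`, since there is only one conjugacy class with trace `2`. … Since both homotopy spheres
arising from `A₀` are standard (by [AK1] for the untwisted framing and Theorem 4.3 below, or [AK2]
followed by [Sig0], in the twisted case), the result follows." — every Cappell–Shaneson sphere of
every `Aₘ = !![0, 1, 0; 0, 1, 1; 1, 0, m + 1]`, either framing, is diffeomorphic to `S⁴` (also
Akbulut, Ann. of Math. 171 (2010), Thm. 1).

Provefact triage **XL**, for the reason recorded in Part III of the parent file: at `Type` the
fact is *equivalent* to the family barrier (`cappellShanesonFamilyBarrier_iff_familyStandard`)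
and contains [AK1] and Theorem 4.3 on the tree's concrete manifolds
(`FamilyStandard.akbulutKirby1979_linearStraightening`, `FamilyStandard.gompf2010_thm43` below),
so its discharge is exactly the discharge of the two remaining topological leaves of the tree's
decomposition of Examples 3.1(a) — the framed Theorem 2.1 for the Δ-moves **F**
(`Literature.Topology.FourManifolds.gompf2010_framedTwist`: fishtail neighbourhoods, logarithmic
transformations of multiplicity one, Lemma 2.2) and [AK1] in the framed form
(`Literature.Topology.FourManifolds.akbulutKirby1979_linearStraightening`: the cancelling handle
diagram of Akbulut–Kirby 1979) — which are named facts of the tree, owned by their own units, and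
are neither restated nor split here (D-0026).

Proved here, sorry-free and without new definitions:

* the **universe lift** `familyStandard_of_familyStandard_zero : FamilyStandard.{0} →
  FamilyStandard.{u}`: Gompf's concrete spheres `X^σ_{Aₘ} = gompfSphere (cappellShanesonMatrix m) γ`
  live in `Type` and, by the classification of Cappell–Shaneson spheres by straightenings proved
  in the tree (`gompf2010_straightening_classification_holds`, §4 ¶2), decide standardness in
  every universe (`familyStandard_of_gompfSphere`, `familyStandard_zero_iff_gompfSphere`) — so ONE
  discharge at `Type`, equivalently `CappellShanesonFamilyBarrier`
  (`familyStandard_of_cappellShanesonFamilyBarrier`), gives the universe-polymorphic fact;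
* the one-line assemblies of `FamilyStandard.{u}` from each recorded leaf set: {**F**, [AK1]}
  (`familyStandard_of_framedTwist_AK` — `FamilyStandard_holds` will be this theorem applied to
  `gompf2010_framedTwist_holds` and `akbulutKirby1979_linearStraightening_holds`), {**F**, **F₀**,
  [AK1]} (`familyStandard_of_twist_AK`), the Δ-move at `Type` with both `A₀`-spheres standard
  (`familyStandard_of_deltaMove_of_akbulutKirby`, Examples 3.1(a) as printed; under the Δ-move
  `FamilyStandard.{0} ↔ AllSpheresStandard.{0} A₀`, `familyStandard_zero_iff_akbulutKirby`), and
  the historical route **F** + both concrete `A₀`-spheres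
  (`familyStandard_of_framedTwist_of_gompfSphere`: [AK1], and [AK2] followed by [Sig0]);
* what any discharge contains: `FamilyStandard.{0}` implies [AK1] (framed and framing-free) and
  Theorem 4.3 (framed and framing-free at `Type`).

Deliberately NOT here: any statement of **F** or [AK1] (they are
`Literature.Topology.FourManifolds.gompf2010_framedTwist` and
`Literature.Topology.FourManifolds.akbulutKirby1979_linearStraightening`); matrices outside the
family `Aₘ` (Parts I–II of the parent file).

## References

* [GompfAGT2010] R. E. Gompf, *More Cappell–Shaneson spheres are standard*, Algebr. Geom. Topol.
  10 (2010) 1665–1681, Examples 3.1(a) (p. 1671), §4 ¶2–¶5, Thm. 4.3 and the remark following it.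
* [AkbulutKirby1979] S. Akbulut, R. Kirby, *An exotic involution of `S⁴`*, Topology 18 (1979)
  75–81 (Gompf's [AK1]).
* [AkbulutKirby1985] S. Akbulut, R. Kirby, *A potential smooth counterexample in dimension 4 to
  the Poincaré conjecture, the Schoenflies conjecture, and the Andrews–Curtis conjecture*, Topology
  24 (1985) 375–390 (Gompf's [AK2]), §1.
* [Gompf1991Killing] R. E. Gompf, *Killing the Akbulut–Kirby 4-sphere, with relevance to the
  Andrews–Curtis and Schoenflies problems*, Topology 30 (1991) 97–115 (Gompf's [Sig0]).
* [Akbulut2010] S. Akbulut, *Cappell–Shaneson homotopy spheres are standard*, Ann. of Math. 171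
  (2010) 2171–2175, Thm. 1.
-/

noncomputable section

open scoped Manifold ContDiff
open Set Literature.Topology.FourManifolds

namespace Literature.Barriers.SmoothPoincare4

universe u

section FamilyStandardLeaves

/-- **`FamilyStandard` matrix by matrix**: "both homotopy spheres associated to `Aₘ` are
diffeomorphic to `S⁴`" for every `m` (`AllSpheresStandard.{u} (cappellShanesonMatrix m)`), at an
arbitrary universe `u`. [cite: GompfAGT2010, Examples 3.1(a)] -/
theorem familyStandard_iff_allSpheresStandard :
    FamilyStandard.{u} ↔ ∀ m : ℤ, AllSpheresStandard.{u} (cappellShanesonMatrix m) :=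
  ⟨allSpheresStandard_cappellShanesonMatrix, fun h X _ _ _ _ _ _ m hX => h m X hX⟩

/-- **From Gompf's concrete spheres to `FamilyStandard` in every universe.** If each concrete
sphere `X^σ_{Aₘ} = gompfSphere (cappellShanesonMatrix m) γ` (`γ` a smooth path from `1` to `Aₘ`
framing the tube of the section circle; both straightening classes, i.e. both framings, occur) is
diffeomorphic to `S⁴`, then *every* Cappell–Shaneson sphere `X : Type u` of every `Aₘ` is `S⁴` —
by the classification of Cappell–Shaneson spheres by straightenings proved in the tree
(`allSpheresStandard_of_gompfSphere`, from `gompf2010_straightening_classification_holds`; Gompf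
2010, §4 ¶2: the two straightenings "canonically determine … the two resulting diffeomorphism
types, which we denote by `X^σ`"). [cite: GompfAGT2010, Examples 3.1(a) and §4 ¶2] -/
theorem familyStandard_of_gompfSphere
    (h : ∀ (m : ℤ) (γ : SmoothMatrixPath (slRealMatrix (cappellShanesonMatrix m))),
      Nonempty (gompfSphere (cappellShanesonMatrix m) γ ≃ₘ⟮𝓡 4, 𝓡 4⟯
        (Metric.sphere (0 : EuclideanSpace ℝ (Fin (4 + 1))) 1))) :
    FamilyStandard.{u} :=
  familyStandard_iff_allSpheresStandard.2 fun m => allSpheresStandard_of_gompfSphere _ (h m)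

/-- **`FamilyStandard` at `Type` in concrete terms**: it holds iff each concrete sphere
`gompfSphere (cappellShanesonMatrix m) γ` is diffeomorphic to `S⁴` (the concrete spheres are
Cappell–Shaneson spheres of `Aₘ`, `isCappellShanesonSphereOf_gompfSphere`, and conversely decide
standardness, §4 ¶2). [cite: GompfAGT2010, Examples 3.1(a) and §4 ¶2] -/
theorem familyStandard_zero_iff_gompfSphere :
    FamilyStandard.{0} ↔
      ∀ (m : ℤ) (γ : SmoothMatrixPath (slRealMatrix (cappellShanesonMatrix m))),
        Nonempty (gompfSphere (cappellShanesonMatrix m) γ ≃ₘ⟮𝓡 4, 𝓡 4⟯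
          (Metric.sphere (0 : EuclideanSpace ℝ (Fin (4 + 1))) 1)) :=
  cappellShanesonFamilyBarrier_iff_familyStandard.symm.trans
    cappellShanesonFamilyBarrier_iff_gompfSphere

/-- **Universe lift.** `FamilyStandard` at `Type` implies `FamilyStandard` at every universe
`u`: Gompf's concrete spheres `X^σ_{Aₘ}` live in `Type`, and by the classification by
straightenings they decide the standardness of every Cappell–Shaneson sphere of `Aₘ` in every
universe. Consequently one discharge at `Type` — equivalently `CappellShanesonFamilyBarrier`
(`cappellShanesonFamilyBarrier_iff_familyStandard`) — yields the universe-polymorphic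
`FamilyStandard_holds`. [cite: GompfAGT2010, §4 ¶2 (X^σ well defined; framings ↔ straightenings)] -/
theorem familyStandard_of_familyStandard_zero (h : FamilyStandard.{0}) : FamilyStandard.{u} :=
  familyStandard_of_gompfSphere (familyStandard_zero_iff_gompfSphere.1 h)

/-- `FamilyStandard` in every universe from the family barrier
`CappellShanesonFamilyBarrier = ¬ ExoticCappellShanesonSphere (range cappellShanesonMatrix)`.
[cite: GompfAGT2010, Examples 3.1(a)] -/
theorem familyStandard_of_cappellShanesonFamilyBarrier (h : CappellShanesonFamilyBarrier) :
    FamilyStandard.{u} :=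
  familyStandard_of_familyStandard_zero (cappellShanesonFamilyBarrier_iff_familyStandard.1 h)

/-- **`FamilyStandard` from the current leaf set {F, [AK1]}** of the tree's decomposition of
Gompf 2010, Examples 3.1(a): the framed Theorem 2.1 for the Δ-moves **F**
(`Literature.Topology.FourManifolds.gompf2010_framedTwist`, §4 ¶3 with Thm 2.1: for `A` in
standard form, `X^γ_A ≅ X^{γ·τ}_{Δᵏ A}` and `X^γ_A ≅ X^{γ·τ}_{A Δᵏ}`) and [AK1] in the framed form
(`Literature.Topology.FourManifolds.akbulutKirby1979_linearStraightening`: Gompf's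
`X^{σ_lin}_{A₀}` is `S⁴`, Akbulut–Kirby 1979), everything else — the Δ₀-instance **F₀**
(`gompf2010_framedTwistZero_of_framedTwist`), the framings of the section circle, the
classification by straightenings, conjugation invariance, `π₁ GL⁺(3, ℝ) = ℤ/2` and the essential
framing loop of the proof of Thm 4.3 — being proved in the tree
(`nonempty_diffeomorph_sphere_four_of_isCappellShanesonSphereOf_of_framedTwist_AK`,
`GompfFramedTwistZero.lean`). When the two leaves are discharged, `FamilyStandard_holds` is
this theorem applied to `gompf2010_framedTwist_holds` and
`akbulutKirby1979_linearStraightening_holds`.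
[cite: GompfAGT2010, Examples 3.1(a), §4 ¶3 and Thm 4.3] [cite: AkbulutKirby1979, main theorem (Σ ≅ S⁴)] -/
theorem familyStandard_of_framedTwist_AK (hF : gompf2010_framedTwist)
    (hAK : akbulutKirby1979_linearStraightening) : FamilyStandard.{u} := fun X _ _ _ _ _ _ =>
  nonempty_diffeomorph_sphere_four_of_isCappellShanesonSphereOf_of_framedTwist_AK X hF hAK

/-- `FamilyStandard` from the three geometric leaves **F**, **F₀**, [AK1]
(`nonempty_diffeomorph_sphere_four_of_isCappellShanesonSphereOf_of_twist_AK`,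
`GompfSectionCircleFramings.lean`); superseded by `familyStandard_of_framedTwist_AK` since **F₀**
follows from **F**. [cite: GompfAGT2010, Examples 3.1(a), §4 ¶3 and ¶5, Thm 4.3] -/
theorem familyStandard_of_twist_AK (hF : gompf2010_framedTwist) (hF₀ : gompf2010_framedTwistZero)
    (hAK : akbulutKirby1979_linearStraightening) : FamilyStandard.{u} := fun X _ _ _ _ _ _ =>
  nonempty_diffeomorph_sphere_four_of_isCappellShanesonSphereOf_of_twist_AK X hF hF₀ hAK

/-- **Examples 3.1(a) as printed, in every universe**: granted the Δ-move at `Type`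
(`gompf2010_deltaMove.{0}`, Thm 2.1/§3: "Since `Aₘ` is in standard form with `d = 1`, we can
change it to have any trace, say `2`") and that both spheres of `A₀` are standard ("by [AK1] for
the untwisted framing and Theorem 4.3 below, or [AK2] followed by [Sig0], in the twisted case"),
`FamilyStandard.{u}` follows — the reduction to `A₀` at `Type`
(`cappellShanesonFamilyBarrier_of_deltaMove_of_akbulutKirby`, conjugation
`E_m⁻¹ (Δ^{-m} Aₘ) E_m = A₀`) and the universe lift. [cite: GompfAGT2010, Examples 3.1(a)] -/
theorem familyStandard_of_deltaMove_of_akbulutKirby (hΔ : gompf2010_deltaMove.{0})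
    (h₀ : AllSpheresStandard.{0} akbulutKirbyMatrix) : FamilyStandard.{u} :=
  familyStandard_of_cappellShanesonFamilyBarrier
    (cappellShanesonFamilyBarrier_of_deltaMove_of_akbulutKirby hΔ h₀)

/-- Under the Δ-move at `Type`, `FamilyStandard.{0}` is *equivalent* to the standardness of the
spheres of the single matrix `A₀` (Examples 3.1(a): every `Aₘ` is Δ-moved and conjugated to
`A₀`; conversely `A₀ = cappellShanesonMatrix 0`). [cite: GompfAGT2010, Examples 3.1(a)] -/
theorem familyStandard_zero_iff_akbulutKirby (hΔ : gompf2010_deltaMove.{0}) :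
    FamilyStandard.{0} ↔ AllSpheresStandard.{0} akbulutKirbyMatrix :=
  ⟨fun h => (cappellShanesonFamilyBarrier_iff_familyStandard.2 h).allSpheresStandard_akbulutKirby,
    fun h₀ => familyStandard_of_deltaMove_of_akbulutKirby hΔ h₀⟩

/-- **The historical route, in every universe**: the framed Δ-move **F** and *both* concrete
`A₀`-spheres `gompfSphere A₀ γ ≅ S⁴` (in print [AK1] for the untwisted framing, [AK2] followed
by [Sig0] = Gompf 1991 for the twisted one) give `FamilyStandard.{u}`
(`cappellShanesonFamilyBarrier_of_framedTwist_of_gompfSphere` and the universe lift).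
[cite: GompfAGT2010, §1 and Examples 3.1(a)] [cite: AkbulutKirby1985, §1] [cite: Gompf1991Killing, main theorem] -/
theorem familyStandard_of_framedTwist_of_gompfSphere (hF : gompf2010_framedTwist)
    (h₀ : ∀ γ : SmoothMatrixPath (slRealMatrix akbulutKirbyMatrix),
      Nonempty (gompfSphere akbulutKirbyMatrix γ ≃ₘ⟮𝓡 4, 𝓡 4⟯
        (Metric.sphere (0 : EuclideanSpace ℝ (Fin (4 + 1))) 1))) :
    FamilyStandard.{u} :=
  familyStandard_of_cappellShanesonFamilyBarrier
    (cappellShanesonFamilyBarrier_of_framedTwist_of_gompfSphere hF h₀)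

/-! ### What any discharge of `FamilyStandard` contains -/

/-- **`FamilyStandard.{0}` contains [AK1]** in the framed form
`akbulutKirby1979_linearStraightening` (Gompf's concrete `X^{σ_lin}_{A₀}` is `S⁴`): the concrete
sphere is a Cappell–Shaneson sphere of `A₀ = cappellShanesonMatrix 0` in `Type`. So no proof of
`FamilyStandard` can bypass [AK1] on the tree's concrete manifold. [cite: AkbulutKirby1979, main theorem (Σ ≅ S⁴)] [cite: GompfAGT2010, §1 (on AK1)] -/
theorem FamilyStandard.akbulutKirby1979_linearStraightening (h : FamilyStandard.{0}) :
    Literature.Topology.FourManifolds.akbulutKirby1979_linearStraightening :=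
  (cappellShanesonFamilyBarrier_iff_familyStandard.2 h).akbulutKirby1979_linearStraightening

/-- `FamilyStandard.{0}` contains the framing-free [AK1] leaf `akbulutKirby1979_sphere_four`.
[cite: AkbulutKirby1979, main theorem (Σ ≅ S⁴)] -/
theorem FamilyStandard.akbulutKirby1979_sphere_four (h : FamilyStandard.{0}) :
    Literature.Topology.FourManifolds.akbulutKirby1979_sphere_four :=
  (cappellShanesonFamilyBarrier_iff_familyStandard.2 h).akbulutKirby1979_sphere_four

/-- **`FamilyStandard.{0}` contains Theorem 4.3** in the framed form `gompf2010_thm43` (all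
concrete `A₀`-spheres are diffeomorphic to each other — here because each is `S⁴`; Gompf: "Of
course, this follows from knowing that both manifolds are `S⁴`"). [cite: GompfAGT2010, Thm 4.3 (and the remark following it)] -/
theorem FamilyStandard.gompf2010_thm43 (h : FamilyStandard.{0}) :
    Literature.Topology.FourManifolds.gompf2010_thm43 :=
  (cappellShanesonFamilyBarrier_iff_familyStandard.2 h).gompf2010_thm43

/-- `FamilyStandard.{0}` contains the framing-free Theorem 4.3 leaf
`gompf2010_akbulutKirby_framings` at `Type`. [cite: GompfAGT2010, Thm 4.3] -/
theorem FamilyStandard.gompf2010_akbulutKirby_framings (h : FamilyStandard.{0}) :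
    Literature.Topology.FourManifolds.gompf2010_akbulutKirby_framings.{0, 0} :=
  (cappellShanesonFamilyBarrier_iff_familyStandard.2 h).gompf2010_akbulutKirby_framings

end FamilyStandardLeaves

end Literature.Barriers.SmoothPoincare4

end
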